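import Summits.CriticalPhenomena.PercolationContinuityZ3.Theorems.PercNearOneGluingNoHeavyLowerTailSahiE3ExchangeCross
import Mathlib.Tactic.Linarith
import Mathlib.Tactic.Ring
import HarnessLib
import HarnessLib.Audit

/-!
# `NoHeavyLowerTail` (crux stmt-CriticalPhenomena-4575), Sahi programme P4: base of the clause induction — the mixed coefficient of a cylinder slot

Support file (cell `prim-l12`, seat P4, generation 20; `--supports stmt-CriticalPhenomena-4575`).  No named facts, no sorries;
standard axioms; def-free.

Context (HOME prim-l12-p4/FROM-prim-l12-p4-gen20-OR-PEEL.md, F2).  The OR-peel `…SahiE3ZstarOrPeel.zstar_or_peel` reduces the mixed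
coefficient `Z*_{V,z₁∨⋯∨z_m}` of the AND-gluing composite to `Z*_{V,∅}` plus the exchange inequalities.  For the EMPTY inner slot
(`G'' = ∅`: `U₁ = A`, `u₁ = v`, `R0 = Φ = R_A` the cylinder certificate) the mixed coefficient is
  `Z*_{V,∅}(S₀⊆S₁, S₀'⊆S₁') = R_A(S₁∩S₁') + R_A(S₀∩S₀') + v(s₁s₀' + s₀s₁') − s₁a(S₀') − s₁'a(S₀) − s₀a(S₁') − s₀'a(S₁)`
and THEOREM `zstar_base_nonneg`: it is `≥ 0` for nested pairs, given `R_A ≥ 0` and the pair inequality of `R_A` at the two cross pairs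
`(S₁,S₀')`, `(S₀,S₁')` — by the modularity of `R_A` over `(S₁∖S₀)×(S₁'∖S₀')` (`…SahiE3ExchangeCross.modularity_nested`) it equals
`[modularity] + pairslack(S₁,S₀') + pairslack(S₀,S₁')`.
-/

namespace Summit.CriticalPhenomena.PercolationContinuityZ3.Theorems.SahiE3ZstarBase

open Finset SahiE3ExchangeCross
open scoped BigOperators

variable {M : Type*} [Fintype M] [DecidableEq M]

/-- **Base of the clause induction.**  `μ` a weight on `M`, `A ⊆ M` the slot (`a(X) = μ(X∩A)`, `v` a scalar), `R ≥ 0` with the pair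
inequality `s·a(S') + s'·a(S) − v·s·s' ≤ R(S∩S')` at the cross pairs `(S₁,S₀')` and `(S₀,S₁')` of two nested pairs `S₀ ⊆ S₁`,
`S₀' ⊆ S₁'`.  Then `R(S₁∩S₁') + R(S₀∩S₀') + v(s₁s₀'+s₀s₁') − s₁a(S₀') − s₁'a(S₀) − s₀a(S₁') − s₀'a(S₁) ≥ 0`. [this work] -/
theorem zstar_base_nonneg (μ R : M → ℝ) (A S₁ S₀ S₁' S₀' : Finset M) (v : ℝ) (hR : ∀ m, 0 ≤ R m)
    (h₀ : S₀ ⊆ S₁) (h₀' : S₀' ⊆ S₁')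
    (hpair₁ : (∑ m ∈ S₁, μ m) * (∑ m ∈ S₀' ∩ A, μ m) + (∑ m ∈ S₀', μ m) * (∑ m ∈ S₁ ∩ A, μ m)
        - v * (∑ m ∈ S₁, μ m) * (∑ m ∈ S₀', μ m) ≤ ∑ m ∈ S₁ ∩ S₀', R m)
    (hpair₂ : (∑ m ∈ S₀, μ m) * (∑ m ∈ S₁' ∩ A, μ m) + (∑ m ∈ S₁', μ m) * (∑ m ∈ S₀ ∩ A, μ m)
        - v * (∑ m ∈ S₀, μ m) * (∑ m ∈ S₁', μ m) ≤ ∑ m ∈ S₀ ∩ S₁', R m) :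
    0 ≤ (∑ m ∈ S₁ ∩ S₁', R m) + (∑ m ∈ S₀ ∩ S₀', R m)
        + v * ((∑ m ∈ S₁, μ m) * (∑ m ∈ S₀', μ m) + (∑ m ∈ S₀, μ m) * (∑ m ∈ S₁', μ m))
        - (∑ m ∈ S₁, μ m) * (∑ m ∈ S₀' ∩ A, μ m) - (∑ m ∈ S₁', μ m) * (∑ m ∈ S₀ ∩ A, μ m)
        - (∑ m ∈ S₀, μ m) * (∑ m ∈ S₁' ∩ A, μ m) - (∑ m ∈ S₀', μ m) * (∑ m ∈ S₁ ∩ A, μ m) := by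
  have hmod := modularity_nested R (univ : Finset M) S₁ S₀ S₁' S₀' (fun m _ => hR m) h₀ h₀'
  simp only [Finset.inter_univ] at hmod
  linarith

end Summit.CriticalPhenomena.PercolationContinuityZ3.Theorems.SahiE3ZstarBase
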